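import Summits.QuantumFields.BalabanUV.Beta.WardLocusQuartic
import Summits.QuantumFields.BalabanUV.Beta.SecondOrderContactMmRead
import Summits.QuantumFields.BalabanUV.Beta.LagrangeFoldWard

/-!
# `BalabanUV.Beta.WardLocusQuarticWall` — binder row D1, (L4) W-side of hW: THE WALL INSTANCE of `WardLocusQuartic` — the site Ward law
# of the next level's quartic table `e4OfKW Lc G_j (SpureRecAt j) (M1At j) (WrecAt j)` of the recursive W-literal v2.26, from ONLY the
# level-`j` kernel law of the carrier `WrecAt j` (β sub-cell, D1 formalisation swarm, unit `b2b-balaban-beta-d1-formalise-leaf-10`, gen 3;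
# CLAIM «D1-hW-L4-WARD-STEP», journal l.11266)

NOT IN PRINT; OUR BOOKKEEPING.  HONEST FRAMING (cell charter, verbatim): «discharging `BetaPertH` makes Bałaban's UV stability
UNCONDITIONAL — a real constructive-QFT result; it is NOT the continuum limit and NOT the Clay problem.»  HONEST DEPENDENCY (verbatim):
«continuum YM on T⁴ ⇐ BetaPertH ∧ nine spine estimates (0/9 proved); BetaPertH ⇐ (D1) ∧ (D4) ∧ CAP+tail; G-an2-4 gates asym, D1 and
NE2/3/4.»  [folklore] kernel algebra over tree objects BY NAME; the level-`j` second-order kernel law is a DISPLAYED HYPOTHESIS; no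
statement of Bałaban's papers, no `[cite:]`, no `def`, no `def … : Prop`; instantiates NO binder of the β-function wall.  NOT D1, NOT
`BetaPertH`, NOT continuum, NOT Clay.

WHAT.  Over `G_j = coDressKBmAt ρ Lc (KInvStep Lc j)`, `𝕄_j = bhKStepAt j`, `E = axEc ρ Lc` (in-block root `ρ = toSite r`), tables
`SpureRecAt j` / `M1At j`, carrier `WrecAt j` (`SpineRecursiveW`), at the pin `(cE, cVH) = (Lc^{d+1}, −Lc^{d+1}·½·Lc^{d+1})` with generator scale
`½`: `dM_SpureRecAt_M1At` ((c1) at every level, leaf-10 gen 2's `LagrangeFoldSrec` splits), `divV_dM_SpureRecAt_M1At_pin` (the first-order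
law (hD) at every level, leaf-10 gen 2's `LagrangeFoldWard`), and **`divV_e4OfKW_wall`**: every level-independent input of
`WardLocusQuartic.divV_e4OfKW_eq` is a LANDED theorem BY NAME (`decays_coDressKBmAt_KInvStep`, `spr_bhKStepAt`, `spr_axEc`,
`relInv_coDressKBmAt_KInvStep_bhKStepAt`, `comp_axEc_diagK_comm`, `loc_diagK_smul_sum_legInd`, `SecondOrderTransport.loc_dM`,
`locStencil_SpureRecAt`, `vertexFamily_M1At`, `WrecAt_loc₂`); the ONLY hypothesis is the level-`j` KERNEL law `hWd` of `WrecAt j` with its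
localised residual `𝒩` (the induction hypothesis, supplied at each level by `KernelWardSymAssembly` from the level-`j` table laws); the
contact is against the E-letter `e3OfK Lc G_j (SrecAt j)` of the next first-order table (an2-g18's `mmRead_K2OfK_eq_e3OfK`).
Provenance: D1 formalisation swarm, leaf prover 10 (gen 3), 2026-08-20; no existing file touched.
-/

noncomputable section

open Finset
open scoped BigOperators
open Literature.MathematicalPhysics.QuantumFieldTheory
open Literature.MathematicalPhysics.QuantumFieldTheory.Balaban1983to89
open Literature.MathematicalPhysics.QuantumFieldTheory.Balaban1983to89.Beta
open ExpKernelCalculus (MKer Decays BiLoc VertexFamily VertexFamily₂ comp)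
open KernelWard (divV divW)
open AffineAveraging (box toSite)
open OneStepResolventKernel (Fib LocStencil)
open OneStepKernelFamily (KInvStep colH vertexOfK)
open BalabanStepJetsSucc (mmRead wE wVH)
open SecondOrderResponse (vertexOfM dM K2OfK)
open BalabanStepW2 (K3OfK)
open AveragingHessianKernelsRooted (vhSAt)
open Summit.QuantumFields.BalabanUV.Beta.TameKernelCalculus
open Summit.QuantumFields.BalabanUV.Beta.ChartConjugation (conjV)
open Summit.QuantumFields.BalabanUV.Beta.ChartConjugationRelative (RelInv)
open Summit.QuantumFields.BalabanUV.Beta.BorderedHessian (diagK bhKStepAt spr_bhKStepAt comp_axEc_diagK_comm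
  relInv_coDressKBmAt_KInvStep_bhKStepAt)
open Summit.QuantumFields.BalabanUV.Beta.AveragingWardRootedStencils (legInd)
open Summit.QuantumFields.BalabanUV.Beta.AxialDressingRooted (coDressKBmAt axEc spr_axEc decays_coDressKBmAt_KInvStep)
open Summit.QuantumFields.BalabanUV.Beta.SpineRooted (e4OfKW SpureRecAt SpureRecAt_zero_level SpureRecAt_succ M1At e3OfK WrecAt
  locStencil_SpureRecAt WrecAt_loc₂ vertexFamily_M1At)
open Summit.QuantumFields.BalabanUV.Beta.WardLocusRecursive (SrecAt)
open Summit.QuantumFields.BalabanUV.Beta.SecondOrderContactMmRead (mmRead_K2OfK_eq_e3OfK)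
open Summit.QuantumFields.BalabanUV.Beta.LagrangeFoldWard (divV_dM_pure_succ_eq_conjV divV_dM_pure_zero_eq_conjV)
open Summit.QuantumFields.BalabanUV.Beta.WardLocusQuartic (divV_e4OfKW_eq)

namespace Summit.QuantumFields.BalabanUV.Beta.WardLocusQuarticWall

section Wall

variable {d Lc : ℕ} [NeZero Lc]

/-- [folklore] **(c1) AT EVERY LEVEL for the unfolded tables**: `dM G_j Lc (SpureRecAt j) (M1At j) b = vertexOfK G_j Lc (SrecAt j) b`
(in-block root; leaf-10 gen 2's `LagrangeFoldSrec` splits, by cases on the level). -/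
theorem dM_SpureRecAt_M1At {r : Fin (d + 1) → ℕ} (hr : r ∈ box (d + 1) Lc) (cE cVH cΛ : ℝ) :
    ∀ (j : ℕ) (μ : Fin (d + 1)) (y : Fin (d + 1) → ℤ),
      dM (coDressKBmAt (toSite r) Lc (KInvStep (d := d) Lc j)) Lc (SpureRecAt d Lc (toSite r) cE cVH cΛ j) (M1At d Lc (toSite r) cΛ j) μ y =
        vertexOfK (coDressKBmAt (toSite r) Lc (KInvStep (d := d) Lc j)) Lc (SrecAt d Lc (toSite r) cE cVH cΛ j) μ y
  | 0, μ, y => by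
    rw [SecondOrderResponse.dM, SpureRecAt_zero_level, WardLocusRecursive.SrecAt_zero, LagrangeFoldSrec.vertexOfK_S0NAt_split hr cE cVH cΛ μ y]
  | j + 1, μ, y => by
    rw [SecondOrderResponse.dM, SpureRecAt_succ, LagrangeFoldSrec.vertexOfK_SrecAt_succ_split hr cE cVH cΛ j μ y]

/-- [folklore] **THE FIRST-ORDER LAW (hD) OF THE WALL LITERAL AT THE PIN** `(cE, cVH) = (Lc^{d+1}, −Lc^{d+1}·½·Lc^{d+1})`, every level, generator scale
`½` (leaf-10 gen 2's `LagrangeFoldWard`, by cases on the level). -/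
theorem divV_dM_SpureRecAt_M1At_pin {r : Fin (d + 1) → ℕ} (hr : r ∈ box (d + 1) Lc) (cΛ : ℝ) :
    ∀ (j : ℕ) (y : Fin (d + 1) → ℤ),
      divV (dM (coDressKBmAt (toSite r) Lc (KInvStep (d := d) Lc j)) Lc
          (SpureRecAt d Lc (toSite r) ((Lc : ℝ) ^ (d + 1)) (-((Lc : ℝ) ^ (d + 1) * (1 / 2) * (Lc : ℝ) ^ (d + 1))) cΛ j)
          (M1At d Lc (toSite r) cΛ j)) y =
        conjV (bhKStepAt d (toSite r) Lc j) (diagK (((1 : ℝ) / 2) • ∑ v ∈ box (d + 1) Lc, legInd (toSite r) ((Lc : ℤ) • y + toSite v)))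
  | 0, y => by rw [SpureRecAt_zero_level]; exact divV_dM_pure_zero_eq_conjV hr cΛ y
  | j + 1, y => by rw [SpureRecAt_succ]; exact divV_dM_pure_succ_eq_conjV hr cΛ j y

/-- [folklore] **THE WALL INSTANCE OF THE SITE LAW.**  For the recursive W-literal over `G_j = coDressKBmAt ρ Lc (KInvStep Lc j)`,
`𝕄_j = bhKStepAt j`, `E = axEc ρ Lc` at the pin (in-block root `ρ = toSite r`): every level-independent input is a LANDED theorem
(`decays_coDressKBmAt_KInvStep`, `spr_bhKStepAt`, `spr_axEc`, `relInv_coDressKBmAt_KInvStep_bhKStepAt`, `comp_axEc_diagK_comm`,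
`loc_diagK_smul_sum_legInd`, `SecondOrderTransport.loc_dM`, `WrecAt_loc₂`, the first-order law `divV_dM_SpureRecAt_M1At_pin`); the ONLY
hypothesis is the level-`j` KERNEL law `hWd` of the carrier `WrecAt j` with its localised residual `𝒩` (the induction hypothesis, supplied at
each level by `KernelWardSymAssembly` from the level-`j` table laws).  Conclusion, with the E-letter of the next first-order table
(`mmRead Lc (K2OfK G_j …) = e3OfK Lc G_j (SrecAt j)`, an2-g18's `mmRead_K2OfK_eq_e3OfK` + (c1)):
`divV (fun μ y ↦ e4OfKW Lc G_j (SpureRecAt j) (M1At j) (WrecAt j) μ y ν y′) y₀ = ½ • conjV (e3OfK Lc G_j (SrecAt j) ν y′) (diagK (legInd ρ′ y₀)) − mmRead Lc (G_j∘𝒩 y₀ ν y′∘G_j)`. -/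
theorem divV_e4OfKW_wall (hLc : 1 ≤ Lc) {r : Fin (d + 1) → ℕ} (hr : r ∈ box (d + 1) Lc) (cΛ cE₂ cB : ℝ)
    (T : Fin 4 → Fin 4 → Fin 4 → Fin 4 → ℝ)
    {vh₂S : Fin (d + 1) → (Fin (d + 1) → ℤ) → Fin (d + 1) → (Fin (d + 1) → ℤ) → MKer (d + 1) (Fib d)}
    (hB : ∃ C δ : ℝ, 0 < δ ∧ BalabanCompositeJets.LocStencil₂ vh₂S C δ)
    {mixFF : Fin (d + 1) → (Fin (d + 1) → ℤ) → Fin (d + 1) → (Fin (d + 1) → ℤ) → MKer (d + 1) (Fib d)}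
    (hmix : ∃ C δ : ℝ, 0 < δ ∧ SecondOrderResponse.LocStencilFM Lc mixFF C δ) (j : ℕ)
    {𝒩 : (Fin (d + 1) → ℤ) → Fin (d + 1) → (Fin (d + 1) → ℤ) → MKer (d + 1) (Fib d)} (h𝒩 : ∀ y ν y', Loc (𝒩 y ν y'))
    (hWd : ∀ (y : Fin (d + 1) → ℤ) (ν : Fin (d + 1)) (y' : Fin (d + 1) → ℤ),
      divW (WrecAt d Lc (toSite r) ((Lc : ℝ) ^ (d + 1)) (-((Lc : ℝ) ^ (d + 1) * (1 / 2) * (Lc : ℝ) ^ (d + 1))) cΛ cE₂ cB T vh₂S mixFF j) y ν y' =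
        conjV (dM (coDressKBmAt (toSite r) Lc (KInvStep (d := d) Lc j)) Lc
            (SpureRecAt d Lc (toSite r) ((Lc : ℝ) ^ (d + 1)) (-((Lc : ℝ) ^ (d + 1) * (1 / 2) * (Lc : ℝ) ^ (d + 1))) cΛ j)
            (M1At d Lc (toSite r) cΛ j) ν y')
          (diagK (((1 : ℝ) / 2) • ∑ v ∈ box (d + 1) Lc, legInd (toSite r) ((Lc : ℤ) • y + toSite v))) + 𝒩 y ν y')
    (ρ' y₀ : Fin (d + 1) → ℤ) (ν : Fin (d + 1)) (y' : Fin (d + 1) → ℤ) :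
    divV (fun μ y => e4OfKW Lc (coDressKBmAt (toSite r) Lc (KInvStep (d := d) Lc j))
        (SpureRecAt d Lc (toSite r) ((Lc : ℝ) ^ (d + 1)) (-((Lc : ℝ) ^ (d + 1) * (1 / 2) * (Lc : ℝ) ^ (d + 1))) cΛ j)
        (M1At d Lc (toSite r) cΛ j)
        (WrecAt d Lc (toSite r) ((Lc : ℝ) ^ (d + 1)) (-((Lc : ℝ) ^ (d + 1) * (1 / 2) * (Lc : ℝ) ^ (d + 1))) cΛ cE₂ cB T vh₂S mixFF j) μ y ν y') y₀ =
      ((1 : ℝ) / 2) • conjV (e3OfK Lc (coDressKBmAt (toSite r) Lc (KInvStep (d := d) Lc j))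
          (SrecAt d Lc (toSite r) ((Lc : ℝ) ^ (d + 1)) (-((Lc : ℝ) ^ (d + 1) * (1 / 2) * (Lc : ℝ) ^ (d + 1))) cΛ j) ν y') (diagK (legInd ρ' y₀))
        - mmRead Lc (comp (comp (coDressKBmAt (toSite r) Lc (KInvStep (d := d) Lc j)) (𝒩 y₀ ν y'))
            (coDressKBmAt (toSite r) Lc (KInvStep (d := d) Lc j))) := by
  set cE : ℝ := (Lc : ℝ) ^ (d + 1) with hcE
  set cVH : ℝ := -((Lc : ℝ) ^ (d + 1) * (1 / 2) * (Lc : ℝ) ^ (d + 1)) with hcVH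
  obtain ⟨δK, CK, hδK, hCK, hKd⟩ := decays_coDressKBmAt_KInvStep (d := d) hr j
  have hKs : Spr (coDressKBmAt (toSite r) Lc (KInvStep (d := d) Lc j)) := ⟨CK, δK, hδK, hKd⟩
  obtain ⟨Cs, δs, hδs, hS⟩ := locStencil_SpureRecAt (d := d) hLc hr cE cVH cΛ j
  -- the first-order family is localised (common rate `min δs δK`)
  have hDl : ∀ μ y, Loc (dM (coDressKBmAt (toSite r) Lc (KInvStep (d := d) Lc j)) Lc (SpureRecAt d Lc (toSite r) cE cVH cΛ j)
      (M1At d Lc (toSite r) cΛ j) μ y) := fun μ y =>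
    SecondOrderTransport.loc_dM hKd hCK (Cs := |Cs|) (fun κ u => biLoc_of_le (hS κ u) (min_le_left δs δK))
      (vertexFamily_M1At hLc hr cΛ j (le_min hδs.le hδK.le)) (lt_min hδs hδK) (min_le_right δs δK) μ y
  have hWl : ∀ μ y ν y', Loc (WrecAt d Lc (toSite r) cE cVH cΛ cE₂ cB T vh₂S mixFF j μ y ν y') := fun μ y ν y' =>
    ⟨_, _, _, _, SpineRooted.δwRecOf_pos hLc hr cE cVH cΛ cE₂ cB T hB hmix j, WrecAt_loc₂ hLc hr cE cVH cΛ cE₂ cB T hB hmix j μ y ν y'⟩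
  rw [divV_e4OfKW_eq hKs (spr_bhKStepAt hr j) (spr_axEc _ _) (relInv_coDressKBmAt_KInvStep_bhKStepAt hr j) hDl hWl hr ((1 : ℝ) / 2)
      (fun y => KernelWardLevels.loc_diagK_smul_sum_legInd Lc (toSite r) _ y) (fun y => comp_axEc_diagK_comm _ _ _)
      (divV_dM_SpureRecAt_M1At_pin hr cΛ j) h𝒩 hWd ρ' y₀ ν y',
    mmRead_K2OfK_eq_e3OfK _ ν y' (dM_SpureRecAt_M1At hr cE cVH cΛ j ν y')]

end Wall

end Summit.QuantumFields.BalabanUV.Beta.WardLocusQuarticWall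

end
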